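import Literature.IUT.HodgeArakelov.ThetaEvaluationSettingModelAssembly2
import Literature.AnabelianGeometry.EtaleTheta.ThetaKummerInversionTransport
import HarnessLib

/-!
# The class-level inversion binder `h14orbit` of GAP row D-G-w4d010-2f PRODUCED from the FUNCTION-level
# [EtTh] Prop 1.4 (ii) package on the theta function `Θ̈` (proof-only knit; abc-iut-L2-t12 gen 8, row R584)

S. Mochizuki, *The étale theta function and its Frobenioid-theoretic manifestations*, Publ. RIMS **45**
(2009) (refereed): Prop 1.4 (ii) PRIMS-PDF p. 22 («`Θ̈(Ü) = −Θ̈(Ü⁻¹)`», «`Θ̈(−Ü) = −Θ̈(Ü)`»), Thm 1.6 (iii) p. 24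
(«some `Π^tp_X/Π^tp_Y ≅ Z`-conjugate of the corresponding classes»), Def 2.7 p. 41 (`[Π^tp_Y̲̲ : Π^tp_Ÿ̲̲] = 2`);
consumer S. Mochizuki, *Inter-universal Teichmüller theory II* (kurims Dec. 2020) Prop 2.2 (ii) p. 66, Rmk 2.1.1 (i).

PROOF-ONLY (NO definition, NO `Prop` fact, NO instance; every input consumed BY NAME, nothing landed restated).
THE BINDER OF RECORD of GAP-LEDGER row D-G-w4d010-2f (abc-iut-w4-d010 gen 11, p457679
`ThetaEvaluationSettingModelOfOrbitLift.lean`; abc-iut-w5-d169 18:47:02Z evidence row) is the ORBIT statement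
`h14orbit : ∃ τ₀ : Π^tp_X̲̲, τ₀ ∈ Π^tp_Y ∧ autMap(ι|_{Π^tp_X̲̲}, ι^Θ)(η̈^Θ|_{Π^tp_Ÿ̲̲}) = τ₀ · η̈^Θ|_{Π^tp_Ÿ̲̲}` — «the pointed
inversion carries the restricted étale theta class into its `Π^tp_Y̲̲`-orbit». It is NOT derivable over the abstract §1
record (`etaDd` is DATA there), but it IS a theorem as soon as `η̈^Θ` is the Kummer class of a FUNCTION on which `ι`
acts: this file states exactly that, in the binder's own currency, for ANY theta setting / étale theta datum / `X̲̲`-choice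
/ inversion datum `(ι, c)` and ANY abc-iut-L2-t12 `ThetaKummerInput T` with `η̈^Θ = κ(Θ̈)` carrying abc-iut-w5-d125's
FUNCTION-level Prop 1.4 (ii) package {`ιFn` a pull-back of functions over `ι` (`hιFn`), compatible with `Λ(Fn) → Δ_Θ`
(`hΛ`), «`ιFn Θ̈ = const(−1)·Θ̈`» (`hιθ`), the deck identity «`ε • Θ̈ = const(−1)·Θ̈` for `ε ∈ Π^tp_Y ∖ Π^tp_Ÿ`» (`hdeck`)}.
The witness is the deck transformation `τ₀ := ε` of `Ÿ̲̲ → Y̲̲`, which EXISTS under `Sec2Hyps` (abc-iut-w4-d010's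
`exists_deck_element`, [EtTh] Def 2.7) — so NO deck binder and NO class-level hypothesis remains.

* `EtaleThetaDataOfSetting.h14orbit_of_thetaKummer` — LITERALLY the `h14orbit` binder of p457679 (companion form,
  `ι^Θ := c.thetaIso`), from the package; proof = abc-iut-w5-d125's `EtaleThetaData.exists_autMap_comap_etaDd_eq_conj`
  (p416114) at `K := Π^tp_X̲̲` + `exists_deck_element` + `smul_inversionAlpha`.
* `…_of_acts_trivially` — the same with `hΛ` in its collapsed form `c(Λ(ιFn) ζ) = c(ζ)` under «`ι^Θ` acts on `Δ_Θ`
  by `+1`» ([EtTh] Prop 2.2 (i); w5-d125's `coeffMap_hom_eq_iff_of_acts_trivially`).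
* `EtaleThetaData.DoubleUnderline.exists_mem_Huu_mem_GtpY_transport_etaDd_eq_conj_of_thetaKummer` — the
  `Π^tp_X`-LEVEL twin in abc-iut-L2-t1's Thm 1.6 (iii) currency `transport c h` (abc-iut-L2-t2's dictionary
  `transport_eq_autMap`): `∃ τ₀ ∈ Π^tp_X̲̲, τ₀ ∈ Π^tp_Y ∧ transport c h η̈^Θ = conj τ₀ η̈^Θ` — abc-iut-w5-d125's
  `exists_mem_Huu_transport_etaDd_eq_conj_of_thetaKummer` with the clause `τ₀ ∈ Π^tp_Y` KEPT (the orbit is the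
  `Π^tp_Y̲̲`-orbit, not merely the `Π^tp_X̲̲`-orbit).

HONEST FRAMING: [EtTh] Prop 1.4 is classical and undisputed; this is a composition of landed theorems; the abstract
interface binder `h14orbit` stays a hypothesis wherever no function carrier is given; nothing here bears on or takes a
side on [IUTchIII] Cor 3.12; typed ≠ proved elsewhere. Universe `Type` as in `Setting.lean`.
-/

noncomputable section

/-! ### §1. The `h14orbit` binder of D-G-w4d010-2f (abc-iut-L6 currency: `Pi C = Π^tp_X̲̲`, `phi C`, `inversionAlpha`) -/

namespace Literature.IUT.HodgeArakelov

open Literature.AnabelianGeometry.EtaleTheta (ContH1 ThetaSetting RootSystem cyclotome)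
open Literature.AnabelianGeometry.EtaleTheta
open EtaleThetaDataOfSetting CohomologySystemOfContH1

namespace EtaleThetaDataOfSetting

variable {p : ℕ} [Fact p.Prime] {D : Literature.AnabelianGeometry.EtaleTheta.ThetaSetting p}
  {E : D.EtaleThetaData} {l : ℕ} (C : E.DoubleUnderline l)
  (ι : D.PiTemp ≃ₜ* D.PiTemp) (hι : C.Huu.map ι.toMulEquiv.toMonoidHom = C.Huu) (c : ThetaSetting.ThetaCompanion ι)

/-- **`h14orbit` FROM THE FUNCTION-LEVEL [EtTh] Prop 1.4 (ii) PACKAGE** (binder of record of GAP row D-G-w4d010-2f,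
shape VERBATIM that of abc-iut-w4-d010's `prop22_ii'_model_of_inversion_of_classLevel_orbit`, p457679): for an
`X̲̲`-choice `C`, an automorphism `ι` of `Π^tp_X` with `ι(Π^tp_X̲̲) = Π^tp_X̲̲` and theta companion `c`, (H1) `hchar`,
`Sec2Hyps`, and a `ThetaKummerInput T` with `η̈^Θ = κ(Θ̈)` carrying a pull-back of functions `ιFn` over `ι` (`hιFn`,
`hΛ`) with «`ιFn Θ̈ = const(−1)·Θ̈`» and the deck identity `hdeck`: the pair `(ι|_{Π^tp_X̲̲}, ι^Θ)` carries
`η̈^Θ|_{Π^tp_Ÿ̲̲}` to `τ₀ · η̈^Θ|_{Π^tp_Ÿ̲̲}` for some `τ₀ ∈ Π^tp_X̲̲ ∩ Π^tp_Y` (namely a deck transformation of `Ÿ̲̲ → Y̲̲`).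
[cite: MochizukiEtTh2009, Prop 1.4 (ii) p.22] -/
theorem h14orbit_of_thetaKummer [hN : (PiYdd C).Normal] [hYN : D.GtpYdd.Normal] (hS : D.Sec2Hyps)
    (hchar : PiYddCharacteristic C)
    -- the FUNCTION-level [EtTh] Prop 1.4 (ii) package on abc-iut-L2-t12's `ThetaKummerInput`
    (T : D.ThetaKummerInput) (hη : E.etaDd = T.kummerTheta)
    (hdeck : ∀ e' : D.PiTemp, e' ∈ D.GtpY → e' ∉ D.GtpYdd → e' • T.theta = T.const (-1) * T.theta)
    (ιFn : T.Fn →* T.Fn)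
    (hιFn : ∀ (g : Pi C) (f : T.Fn), ιFn ((g : D.PiTemp) • f) = ι (g : D.PiTemp) • ιFn f)
    (hΛ : ∀ ζ : cyclotome T.Fn, ContH1Aut.coeffMap D.DeltaTheta c.thetaIso (thetaCompanion_mem_deltaTheta ι c)
        (T.coeff.hom ζ) = T.coeff.hom (cyclotome.map ιFn ζ))
    (hιθ : ιFn T.theta = T.const (-1) * T.theta) :
    ∃ τ₀ : Pi C, (τ₀ : D.PiTemp) ∈ D.GtpY ∧
      ContH1Aut.autMap (phi C) D.DeltaTheta (inversionAlpha C ι hι) c.thetaIso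
        (thetaCompanion_phi C ι hι c) (thetaCompanion_mem_deltaTheta ι c)
        (symm_mem_inf_top (PiYdd C) (inversionAlpha C ι hι) (mem_PiYdd_iff_of_piYddCharacteristic C hchar _))
        (ContH1.comap D.toTheta D.DeltaTheta C.Huu.subtype continuous_subtype_val
          (map_subtype_piYdd_inf_le_GtpYdd C ⊤) E.etaDd) =
      ContH1.conj (phi C) D.DeltaTheta τ₀
        (ContH1.comap D.toTheta D.DeltaTheta C.Huu.subtype continuous_subtype_val
          (map_subtype_piYdd_inf_le_GtpYdd C ⊤) E.etaDd) :=
  E.exists_autMap_comap_etaDd_eq_conj T hη (map_subtype_piYdd_inf_le_GtpYdd C ⊤) (inversionAlpha C ι hι)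
    c.thetaIso (thetaCompanion_phi C ι hι c) (thetaCompanion_mem_deltaTheta ι c)
    (symm_mem_inf_top (PiYdd C) (inversionAlpha C ι hι) (mem_PiYdd_iff_of_piYddCharacteristic C hchar _))
    ιFn (smul_inversionAlpha C ι hι ιFn hιFn) hΛ hιθ hdeck (exists_deck_element C hS)

/-- The same with the coefficient compatibility in its COLLAPSED form `hΛ' : c(Λ(ιFn) ζ) = c(ζ)` («pull-back by an
automorphism of the curve fixes the roots of unity»), valid whenever `ι^Θ` acts on `Δ_Θ` by `+1` (`hβ`, [EtTh]
Prop 2.2 (i) p. 37 — the consumers' `hβ`; abc-iut-w5-d125's `coeffMap_hom_eq_iff_of_acts_trivially`).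
[cite: MochizukiEtTh2009, Prop 2.2 (i) p.37] -/
theorem h14orbit_of_thetaKummer_of_acts_trivially [hN : (PiYdd C).Normal] [hYN : D.GtpYdd.Normal]
    (hS : D.Sec2Hyps) (hchar : PiYddCharacteristic C) (hβ : ∀ a ∈ D.DeltaTheta, c.thetaIso a = a)
    (T : D.ThetaKummerInput) (hη : E.etaDd = T.kummerTheta)
    (hdeck : ∀ e' : D.PiTemp, e' ∈ D.GtpY → e' ∉ D.GtpYdd → e' • T.theta = T.const (-1) * T.theta)
    (ιFn : T.Fn →* T.Fn)
    (hιFn : ∀ (g : Pi C) (f : T.Fn), ιFn ((g : D.PiTemp) • f) = ι (g : D.PiTemp) • ιFn f)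
    (hΛ' : ∀ ζ : cyclotome T.Fn, T.coeff.hom (cyclotome.map ιFn ζ) = T.coeff.hom ζ)
    (hιθ : ιFn T.theta = T.const (-1) * T.theta) :
    ∃ τ₀ : Pi C, (τ₀ : D.PiTemp) ∈ D.GtpY ∧
      ContH1Aut.autMap (phi C) D.DeltaTheta (inversionAlpha C ι hι) c.thetaIso
        (thetaCompanion_phi C ι hι c) (thetaCompanion_mem_deltaTheta ι c)
        (symm_mem_inf_top (PiYdd C) (inversionAlpha C ι hι) (mem_PiYdd_iff_of_piYddCharacteristic C hchar _))
        (ContH1.comap D.toTheta D.DeltaTheta C.Huu.subtype continuous_subtype_val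
          (map_subtype_piYdd_inf_le_GtpYdd C ⊤) E.etaDd) =
      ContH1.conj (phi C) D.DeltaTheta τ₀
        (ContH1.comap D.toTheta D.DeltaTheta C.Huu.subtype continuous_subtype_val
          (map_subtype_piYdd_inf_le_GtpYdd C ⊤) E.etaDd) :=
  h14orbit_of_thetaKummer C ι hι c hS hchar T hη hdeck ιFn hιFn
    (fun ζ => (T.coeffMap_hom_eq_iff_of_acts_trivially c.thetaIso (thetaCompanion_mem_deltaTheta ι c) hβ ιFn ζ).2
      (hΛ' ζ)) hιθ

end EtaleThetaDataOfSetting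

end Literature.IUT.HodgeArakelov

/-! ### §2. The `Π^tp_X`-level twin in [EtTh] Thm 1.6 (iii) currency (`transport c h` on `H¹(Π^tp_Ÿ, Δ_Θ)`) -/

namespace Literature.AnabelianGeometry.EtaleTheta

namespace ThetaSetting

open Literature.IUT.HodgeArakelov

variable {p : ℕ} [Fact p.Prime] {D : ThetaSetting p}

namespace EtaleThetaData.DoubleUnderline

variable {E : D.EtaleThetaData} (T : D.ThetaKummerInput) {l : ℕ} (C : E.DoubleUnderline l)

/-- **Thm 1.6 (iii) at `γ := ι`, ORBIT FORM, from the FUNCTION-level Prop 1.4 (ii) package**: for an inversion datum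
`(ι, c, h)` of §1 and `T : ThetaKummerInput` with `η̈^Θ = κ(Θ̈)`, a pull-back of functions `ιFn` over `ι` (`hιFn`,
`hcoeff`, `hιθ`) and the deck identity `hdeck`, under `Sec2Hyps`: `∃ τ₀ ∈ Π^tp_X̲̲, τ₀ ∈ Π^tp_Y ∧
transport c h η̈^Θ = conj τ₀ η̈^Θ` — abc-iut-w5-d125's `exists_mem_Huu_transport_etaDd_eq_conj_of_thetaKummer` with
the clause `τ₀ ∈ Π^tp_Y` kept (the class moves inside its `Π^tp_Y̲̲`-ORBIT `{η̈^Θ, ε·η̈^Θ}`, `ε` the deck transformation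
of `Ÿ̲̲ → Y̲̲`). [cite: MochizukiEtTh2009, Thm 1.6 (iii) p.24] -/
theorem exists_mem_Huu_mem_GtpY_transport_etaDd_eq_conj_of_thetaKummer [D.GtpYdd.Normal] (hS : D.Sec2Hyps)
    (hη : E.etaDd = T.kummerTheta) (ι : D.PiTemp ≃ₜ* D.PiTemp) (c : ThetaCompanion ι) (h : Thm16i ι)
    (ιFn : T.Fn →* T.Fn) (hιFn : ∀ (g : D.PiTemp) (f : T.Fn), ιFn (g • f) = ι g • ιFn f)
    (hcoeff : ∀ ζ : cyclotome T.Fn,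
      ContH1Aut.coeffMap D.DeltaTheta c.thetaIso (ThetaCompanion.apply_mem' ι c) (T.coeff.hom ζ) =
        T.coeff.hom (cyclotome.map ιFn ζ))
    (hιθ : ιFn T.theta = T.const (-1) * T.theta)
    (hdeck : ∀ ε : D.PiTemp, ε ∈ D.GtpY → ε ∉ D.GtpYdd → ε • T.theta = T.const (-1) * T.theta) :
    ∃ τ₀ ∈ C.Huu, τ₀ ∈ D.GtpY ∧ transport c h E.etaDd = ContH1.conj D.toTheta D.DeltaTheta τ₀ E.etaDd := by
  obtain ⟨ε, hεH, hε₁, hε₂⟩ := C.exists_mem_Huu_mem_GtpY_not_mem_GtpYdd hS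
  exact ⟨ε, hεH, hε₁, E.transport_etaDd_eq_conj_of_thetaKummer T hη ι c h ιFn hιFn hcoeff hιθ hdeck hε₁ hε₂⟩

/-- The same under «`ι^Θ` acts on `Δ_Θ` by `+1`» (`hβ`, Prop 2.2 (i)) with the collapsed coefficient compatibility
`hΛ' : c(Λ(ιFn) ζ) = c(ζ)`. [cite: MochizukiEtTh2009, Prop 2.2 (i) p.37] -/
theorem exists_mem_Huu_mem_GtpY_transport_etaDd_eq_conj_of_thetaKummer_of_acts_trivially [D.GtpYdd.Normal]
    (hS : D.Sec2Hyps) (hη : E.etaDd = T.kummerTheta) (ι : D.PiTemp ≃ₜ* D.PiTemp) (c : ThetaCompanion ι)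
    (h : Thm16i ι) (hβ : ∀ a ∈ D.DeltaTheta, c.thetaIso a = a)
    (ιFn : T.Fn →* T.Fn) (hιFn : ∀ (g : D.PiTemp) (f : T.Fn), ιFn (g • f) = ι g • ιFn f)
    (hΛ' : ∀ ζ : cyclotome T.Fn, T.coeff.hom (cyclotome.map ιFn ζ) = T.coeff.hom ζ)
    (hιθ : ιFn T.theta = T.const (-1) * T.theta)
    (hdeck : ∀ ε : D.PiTemp, ε ∈ D.GtpY → ε ∉ D.GtpYdd → ε • T.theta = T.const (-1) * T.theta) :
    ∃ τ₀ ∈ C.Huu, τ₀ ∈ D.GtpY ∧ transport c h E.etaDd = ContH1.conj D.toTheta D.DeltaTheta τ₀ E.etaDd :=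
  C.exists_mem_Huu_mem_GtpY_transport_etaDd_eq_conj_of_thetaKummer T hS hη ι c h ιFn hιFn
    (fun ζ => (T.coeffMap_hom_eq_iff_of_acts_trivially c.thetaIso (ThetaCompanion.apply_mem' ι c) hβ ιFn ζ).2
      (hΛ' ζ)) hιθ hdeck

end EtaleThetaData.DoubleUnderline

end ThetaSetting

end Literature.AnabelianGeometry.EtaleTheta

end
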